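import Literature.NumberTheory.GaloisRepresentations.UnramifiedFrameLift
import Literature.NumberTheory.GaloisRepresentations.FrameRingEvaluation
import Literature.NumberTheory.GaloisRepresentations.CrystallineDeformationRing
import HarnessLib

/-!
# Points of the universal unramified lift

Let `K` be a non-archimedean local field, `L/ℚ_p` finite in `ℚ̄_p` with integers `𝒪` and residue
field `k`, `R⁰ = 𝒪⟦X_{ij}⟧`, `σ₀` an arithmetic Frobenius, `g ∈ GL_n(k)`, and
`frameLift : Γ_K → GL_n(R⁰)` the universal unramified lift (`UnramifiedFrameLift`).  For a
`ℚ̄_p`-point `x : R⁰ → ℚ̄_p` (an `𝒪`-algebra homomorphism) write `frameLiftAt x = x ∘ frameLift`.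
We PROVE the four facts making `R⁰` a `PointwiseLiftingRing` for unramified lifts
([BLGGT] §1.2–1.3 in the unramified case, where everything is explicit):

* `continuous_frameLiftAt` — `x ∘ frameLift : Γ_K → GL_n(ℚ̄_p)` is continuous (points are
  `𝔪`-adically continuous, `exists_norm_framePoint_pow_le`, and `frameLift` is `𝔪`-adically
  continuous, `isOpen_setOf_frameLift`);
* `reducesTo_frameLiftAt` — `x ∘ frameLift` reduces to `ρ̄` (`x(𝔪) ⊆ 𝔪_{ℚ̄_p}`);
* `exists_framePoint_frameLiftAt_eq` — every continuous unramified `ρ : Γ_K → GL_n(ℚ̄_p)` reducing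
  to `ρ̄` is `x ∘ frameLift` for some point `x` (evaluate `X ↦ ρ(σ₀) - ĝ`, then two continuous
  unramified homomorphisms with integral Frobenius agreeing at `σ₀` are equal,
  `MonoidHom.eq_of_unramified_of_apply_frob_eq`);
* `framePoint_eq_of_frameLiftAt_eq` — the point is unique.

No named facts, no `sorry`.

## References

* [BLGGT] T. Barnet-Lamb, T. Gee, D. Geraghty, R. Taylor, Ann. of Math. 179 (2014), §1.2–1.3.
  [BarnetlambEtAl2014]
* M. Kisin, *Potentially semi-stable deformation rings*, JAMS 21 (2008), (2.3), (3.3.3). [Kisin2007]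
-/

noncomputable section

open IsLocalRing Field ValuativeRel Filter Topology
open scoped MatrixGroups

namespace Literature.NumberTheory.GaloisRepresentations

open IsNonarchimedeanLocalField

section Points

variable {K : Type} [Field K] [ValuativeRel K] [TopologicalSpace K] [IsNonarchimedeanLocalField K]
  {p : ℕ} [Fact p.Prime] (L : IntermediateField ℚ_[p] (PadicAlgCl p)) [FiniteDimensional ℚ_[p] L] {n : ℕ}
  [Algebra (intermediateFieldIntegers p L) (PadicAlgCl p)]
  [IsScalarTower (intermediateFieldIntegers p L) L (PadicAlgCl p)]
  {σ₀ : absoluteGaloisGroup K} (hσ₀ : IsAbsArithFrob σ₀)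
  (g : GL (Fin n) (ResidueField (intermediateFieldIntegers p L)))

/-- The specialisation `x ∘ frameLift : Γ_K →* GL_n(ℚ̄_p)` of the universal lift at a point. [folklore] -/
def frameLiftAt (x : frameRing L n →ₐ[intermediateFieldIntegers p L] PadicAlgCl p) :
    absoluteGaloisGroup K →* GL (Fin n) (PadicAlgCl p) :=
  (Matrix.GeneralLinearGroup.map (x : frameRing L n →+* PadicAlgCl p)).comp (frameLift L hσ₀ g)

omit [IsScalarTower (intermediateFieldIntegers p L) L (PadicAlgCl p)] in
/-- Entries of `frameLiftAt`. [folklore] -/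
@[simp] theorem frameLiftAt_apply_coe (x : frameRing L n →ₐ[intermediateFieldIntegers p L] PadicAlgCl p)
    (σ : absoluteGaloisGroup K) (i j : Fin n) :
    ((frameLiftAt L hσ₀ g x σ : GL (Fin n) (PadicAlgCl p)) : Matrix (Fin n) (Fin n) (PadicAlgCl p)) i j =
      x (((frameLift L hσ₀ g σ : GL (Fin n) (frameRing L n)) : Matrix (Fin n) (Fin n) (frameRing L n)) i j) :=
  rfl

omit [IsScalarTower (intermediateFieldIntegers p L) L (PadicAlgCl p)] in
/-- `frameLiftAt` is trivial on inertia. [folklore] -/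
theorem frameLiftAt_eq_one_of_mem_absInertia (x : frameRing L n →ₐ[intermediateFieldIntegers p L] PadicAlgCl p)
    {σ : absoluteGaloisGroup K} (hσ : σ ∈ absInertia K) : frameLiftAt L hσ₀ g x σ = 1 := by
  rw [frameLiftAt, MonoidHom.comp_apply, frameLift_eq_one_of_mem_absInertia L hσ₀ g hσ, map_one]

omit [IsScalarTower (intermediateFieldIntegers p L) L (PadicAlgCl p)] in
/-- `I_K ≤ ker (frameLiftAt x)`. [folklore] -/
theorem absInertia_le_ker_frameLiftAt (x : frameRing L n →ₐ[intermediateFieldIntegers p L] PadicAlgCl p) :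
    absInertia K ≤ (frameLiftAt L hσ₀ g x).ker :=
  fun _ hσ => (MonoidHom.mem_ker).2 (frameLiftAt_eq_one_of_mem_absInertia L hσ₀ g x hσ)

/-! #### Continuity -/

/-- The entries of `x ∘ frameLift` tend to those of `1` at `1 ∈ Γ_K`. [folklore] -/
theorem tendsto_frameLiftAt_one (x : frameRing L n →ₐ[intermediateFieldIntegers p L] PadicAlgCl p) (i j : Fin n) :
    Tendsto (fun τ => ((frameLiftAt L hσ₀ g x τ : GL (Fin n) (PadicAlgCl p)) : Matrix (Fin n) (Fin n) (PadicAlgCl p)) i j)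
      (𝓝 1) (𝓝 ((1 : Matrix (Fin n) (Fin n) (PadicAlgCl p)) i j)) := by
  rw [Metric.tendsto_nhds]
  intro ε hε
  obtain ⟨c, -, hc1, hc⟩ := exists_norm_framePoint_pow_le L n x
  obtain ⟨N, hN⟩ := exists_pow_lt_of_lt_one hε hc1
  have hopen := isOpen_setOf_frameLift L hσ₀ g N
  have hmem : (1 : absoluteGaloisGroup K) ∈ {σ : absoluteGaloisGroup K | ∀ i j : Fin n,
      ((frameLift L hσ₀ g σ : GL (Fin n) (frameRing L n)) : Matrix (Fin n) (Fin n) (frameRing L n)) i j -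
        (1 : Matrix (Fin n) (Fin n) (frameRing L n)) i j ∈ maximalIdeal (frameRing L n) ^ N} := by
    intro i j
    rw [map_one, Units.val_one, sub_self]
    exact zero_mem _
  filter_upwards [hopen.mem_nhds hmem] with τ hτ
  have h1 : ((frameLiftAt L hσ₀ g x τ : GL (Fin n) (PadicAlgCl p)) : Matrix (Fin n) (Fin n) (PadicAlgCl p)) i j -
      (1 : Matrix (Fin n) (Fin n) (PadicAlgCl p)) i j =
        x ((((frameLift L hσ₀ g τ : GL (Fin n) (frameRing L n)) : Matrix (Fin n) (Fin n) (frameRing L n)) i j) -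
          (1 : Matrix (Fin n) (Fin n) (frameRing L n)) i j) := by
    rw [map_sub, frameLiftAt_apply_coe, Matrix.one_apply, Matrix.one_apply]
    split_ifs <;> simp
  rw [dist_eq_norm, h1]
  exact (hc N _ (hτ i j)).trans_lt hN

/-- **The matrix-valued map `σ ↦ x(frameLift σ)` is continuous.** [folklore] -/
theorem continuous_frameLiftAt_coe (x : frameRing L n →ₐ[intermediateFieldIntegers p L] PadicAlgCl p) :
    Continuous fun σ => ((frameLiftAt L hσ₀ g x σ : GL (Fin n) (PadicAlgCl p)) : Matrix (Fin n) (Fin n) (PadicAlgCl p)) := by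
  set Φ : absoluteGaloisGroup K → Matrix (Fin n) (Fin n) (PadicAlgCl p) :=
    fun σ => ((frameLiftAt L hσ₀ g x σ : GL (Fin n) (PadicAlgCl p)) : Matrix (Fin n) (Fin n) (PadicAlgCl p)) with hΦ
  refine continuous_iff_continuousAt.2 fun σ₁ => continuousAt_pi.2 fun i => continuousAt_pi.2 fun j => ?_
  have hconj : Tendsto (fun σ : absoluteGaloisGroup K => σ * σ₁⁻¹) (𝓝 σ₁) (𝓝 1) := by
    have h : Tendsto (fun σ : absoluteGaloisGroup K => σ * σ₁⁻¹) (𝓝 σ₁) (𝓝 (σ₁ * σ₁⁻¹)) :=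
      tendsto_id.mul_const _
    rwa [mul_inv_cancel] at h
  have hfun : (fun σ => Φ σ i j) = fun σ => ∑ k, Φ (σ * σ₁⁻¹) i k * Φ σ₁ k j := by
    funext σ
    rw [← Matrix.mul_apply]
    simp only [hΦ]
    rw [← Units.val_mul, ← map_mul, inv_mul_cancel_right]
  have hlim : Φ σ₁ i j = ∑ k, (1 : Matrix (Fin n) (Fin n) (PadicAlgCl p)) i k * Φ σ₁ k j := by
    rw [← Matrix.mul_apply, Matrix.one_mul]
  change Tendsto (fun σ => Φ σ i j) (𝓝 σ₁) (𝓝 (Φ σ₁ i j))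
  rw [hfun, hlim]
  exact tendsto_finsetSum _ fun k _ => ((tendsto_frameLiftAt_one L hσ₀ g x i k).comp hconj).mul_const _

/-- **`x ∘ frameLift : Γ_K → GL_n(ℚ̄_p)` is continuous.** [cite: BarnetlambEtAl2014, §1.2] -/
theorem continuous_frameLiftAt (x : frameRing L n →ₐ[intermediateFieldIntegers p L] PadicAlgCl p) :
    Continuous (frameLiftAt L hσ₀ g x) := by
  refine Units.continuous_iff.2 ⟨continuous_frameLiftAt_coe L hσ₀ g x, ?_⟩
  have h : (fun σ => (((frameLiftAt L hσ₀ g x σ)⁻¹ : GL (Fin n) (PadicAlgCl p)) : Matrix (Fin n) (Fin n) (PadicAlgCl p))) =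
      (fun σ => ((frameLiftAt L hσ₀ g x σ : GL (Fin n) (PadicAlgCl p)) : Matrix (Fin n) (Fin n) (PadicAlgCl p))) ∘
        fun σ => σ⁻¹ := by
    funext σ
    simp only [Function.comp_apply, map_inv]
  rw [h]
  exact (continuous_frameLiftAt_coe L hσ₀ g x).comp continuous_inv

/-- `x ∘ frameLift` as a continuous framed representation. [folklore] -/
def frameLiftAtC (x : frameRing L n →ₐ[intermediateFieldIntegers p L] PadicAlgCl p) :
    FramedRep (absoluteGaloisGroup K) (PadicAlgCl p) n :=
  ⟨frameLiftAt L hσ₀ g x, continuous_frameLiftAt L hσ₀ g x⟩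

/-- The underlying homomorphism of `frameLiftAtC`. [folklore] -/
@[simp] theorem frameLiftAtC_toMonoidHom (x : frameRing L n →ₐ[intermediateFieldIntegers p L] PadicAlgCl p) :
    (frameLiftAtC L hσ₀ g x).toMonoidHom = frameLiftAt L hσ₀ g x := rfl

/-- `frameLiftAtC` applied. [folklore] -/
@[simp] theorem frameLiftAtC_apply (x : frameRing L n →ₐ[intermediateFieldIntegers p L] PadicAlgCl p)
    (σ : absoluteGaloisGroup K) : frameLiftAtC L hσ₀ g x σ = frameLiftAt L hσ₀ g x σ := rfl

/-- `frameLiftAtC x` is locally unramified. [folklore] -/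
theorem frameLiftAtC_isLocallyUnramified (x : frameRing L n →ₐ[intermediateFieldIntegers p L] PadicAlgCl p) :
    (frameLiftAtC L hσ₀ g x).IsLocallyUnramified :=
  fun _ hσ => frameLiftAt_eq_one_of_mem_absInertia L hσ₀ g x hσ

/-! #### Reduction -/

/-- **`x ∘ frameLift` reduces to `ρ̄`** for every continuous unramified `ρ̄` with `ρ̄(σ₀) = g`.
[cite: BarnetlambEtAl2014, §1.2] -/
theorem reducesTo_frameLiftAt (x : frameRing L n →ₐ[intermediateFieldIntegers p L] PadicAlgCl p)
    (ρbar : absoluteGaloisGroup K →* GL (Fin n) (ResidueField (intermediateFieldIntegers p L)))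
    (hunr : absInertia K ≤ ρbar.ker) (hker : IsOpen (ρbar.ker : Set (absoluteGaloisGroup K))) (hg : ρbar σ₀ = g) :
    ReducesTo (intermediateFieldIntegers p L) (frameLiftAt L hσ₀ g x) ρbar := by
  intro γ i j a ha
  rw [frameLiftAt_apply_coe, ← x.commutes a, ← map_sub]
  refine norm_map_lt_one_of_mem_maximalIdeal L x ?_
  rw [mem_maximalIdeal_frameRing_iff, map_sub, frameResidue_frameLift L hσ₀ g ρbar hunr hker hg, AlgHom.commutes, ← ha,
    sub_self]

/-! #### Rigidity of continuous unramified homomorphisms -/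

omit [FiniteDimensional ℚ_[p] L] [Algebra (intermediateFieldIntegers p L) (PadicAlgCl p)]
  [IsScalarTower (intermediateFieldIntegers p L) L (PadicAlgCl p)] in
/-- Entries of powers of a matrix with integral entries are integral. [folklore] -/
theorem norm_pow_apply_le_one {M : Matrix (Fin n) (Fin n) (PadicAlgCl p)} (hM : ∀ i j, ‖M i j‖ ≤ 1) (a : ℕ) (i j : Fin n) :
    ‖(M ^ a) i j‖ ≤ 1 := by
  induction a generalizing i j with
  | zero =>
    rw [pow_zero, Matrix.one_apply]
    split_ifs <;> simp
  | succ a ih =>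
    rw [pow_succ, Matrix.mul_apply]
    refine IsUltrametricDist.norm_sum_le_of_forall_le_of_nonneg zero_le_one fun k _ => ?_
    rw [norm_mul]
    exact mul_le_one₀ (ih i k) (norm_nonneg _) (hM k j)

include hσ₀ in
/-- **Rigidity**: two continuous homomorphisms `Γ_K → GL_n(ℚ̄_p)`, trivial on inertia, with the
same value at the Frobenius `σ₀` and that value integral, are equal (density of `σ₀^ℕ I_K` and the
ultrametric inequality). [folklore] -/
theorem MonoidHom.eq_of_unramified_of_apply_frob_eq {ρ₁ ρ₂ : absoluteGaloisGroup K →* GL (Fin n) (PadicAlgCl p)}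
    (h₁ : Continuous ρ₁) (h₂ : Continuous ρ₂) (hu₁ : absInertia K ≤ ρ₁.ker) (hu₂ : absInertia K ≤ ρ₂.ker)
    (hσ : ρ₁ σ₀ = ρ₂ σ₀)
    (hint : ∀ i j, ‖((ρ₁ σ₀ : GL (Fin n) (PadicAlgCl p)) : Matrix (Fin n) (Fin n) (PadicAlgCl p)) i j‖ ≤ 1) :
    ρ₁ = ρ₂ := by
  refine MonoidHom.ext fun σ => Units.ext (Matrix.ext fun i j => eq_of_forall_dist_le fun ε hε => ?_)
  -- the open neighbourhood of `1` where both are `ε`-close to `1`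
  let U : Set (absoluteGaloisGroup K) := {τ | ∀ i j : Fin n,
    ‖((ρ₁ τ : GL (Fin n) (PadicAlgCl p)) : Matrix (Fin n) (Fin n) (PadicAlgCl p)) i j -
        (1 : Matrix (Fin n) (Fin n) (PadicAlgCl p)) i j‖ < ε ∧
      ‖((ρ₂ τ : GL (Fin n) (PadicAlgCl p)) : Matrix (Fin n) (Fin n) (PadicAlgCl p)) i j -
        (1 : Matrix (Fin n) (Fin n) (PadicAlgCl p)) i j‖ < ε}
  have hc₁ : Continuous fun τ => ((ρ₁ τ : GL (Fin n) (PadicAlgCl p)) : Matrix (Fin n) (Fin n) (PadicAlgCl p)) :=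
    Units.continuous_val.comp h₁
  have hc₂ : Continuous fun τ => ((ρ₂ τ : GL (Fin n) (PadicAlgCl p)) : Matrix (Fin n) (Fin n) (PadicAlgCl p)) :=
    Units.continuous_val.comp h₂
  have hU : IsOpen U := by
    simp only [U, Set.setOf_forall]
    refine isOpen_iInter_of_finite fun i => isOpen_iInter_of_finite fun j => IsOpen.inter ?_ ?_
    · exact isOpen_lt ((hc₁.matrix_elem i j).sub continuous_const).norm continuous_const
    · exact isOpen_lt ((hc₂.matrix_elem i j).sub continuous_const).norm continuous_const
  have hIU : (absInertia K : Set (absoluteGaloisGroup K)) ⊆ U := fun τ hτ i j => by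
    have e₁ : ρ₁ τ = 1 := (MonoidHom.mem_ker).1 (hu₁ hτ)
    have e₂ : ρ₂ τ = 1 := (MonoidHom.mem_ker).1 (hu₂ hτ)
    rw [e₁, e₂, Units.val_one, sub_self, norm_zero]
    exact ⟨hε, hε⟩
  obtain ⟨a, -, ha⟩ := exists_forall_smul_eq_pow_and_mem hσ₀ σ ∅ (by simp) hU hIU
  obtain ⟨u, hu⟩ : ∃ u : absoluteGaloisGroup K, u = (σ₀ ^ a)⁻¹ * σ := ⟨_, rfl⟩
  rw [← hu] at ha
  have hσu : σ = σ₀ ^ a * u := by rw [hu, mul_inv_cancel_left]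
  -- the difference `ρ₁ σ - ρ₂ σ = ρ(σ₀)^a (ρ₁ u - ρ₂ u)`
  obtain ⟨M, hMdef⟩ : ∃ M : Matrix (Fin n) (Fin n) (PadicAlgCl p),
      M = ((ρ₁ σ₀ : GL (Fin n) (PadicAlgCl p)) : Matrix (Fin n) (Fin n) (PadicAlgCl p)) := ⟨_, rfl⟩
  obtain ⟨D, hDdef⟩ : ∃ D : Matrix (Fin n) (Fin n) (PadicAlgCl p),
      D = ((ρ₁ u : GL (Fin n) (PadicAlgCl p)) : Matrix (Fin n) (Fin n) (PadicAlgCl p)) -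
        ((ρ₂ u : GL (Fin n) (PadicAlgCl p)) : Matrix (Fin n) (Fin n) (PadicAlgCl p)) := ⟨_, rfl⟩
  have hdiff : ((ρ₁ σ : GL (Fin n) (PadicAlgCl p)) : Matrix (Fin n) (Fin n) (PadicAlgCl p)) -
      ((ρ₂ σ : GL (Fin n) (PadicAlgCl p)) : Matrix (Fin n) (Fin n) (PadicAlgCl p)) = M ^ a * D := by
    rw [hσu, map_mul, map_mul, map_pow, map_pow, ← hσ, Units.val_mul, Units.val_mul, Units.val_pow_eq_pow_val, hDdef,
      hMdef, mul_sub]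
  have hD : ∀ k l, ‖D k l‖ ≤ ε := fun k l => by
    have e : D k l = (((ρ₁ u : GL (Fin n) (PadicAlgCl p)) : Matrix (Fin n) (Fin n) (PadicAlgCl p)) k l -
        (1 : Matrix (Fin n) (Fin n) (PadicAlgCl p)) k l) +
      -((((ρ₂ u : GL (Fin n) (PadicAlgCl p)) : Matrix (Fin n) (Fin n) (PadicAlgCl p)) k l -
        (1 : Matrix (Fin n) (Fin n) (PadicAlgCl p)) k l)) := by
      rw [hDdef, Matrix.sub_apply]; ring
    rw [e]
    refine (IsUltrametricDist.norm_add_le_max _ _).trans (max_le (ha k l).1.le ?_)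
    rw [norm_neg]
    exact (ha k l).2.le
  have hint' : ∀ i j, ‖M i j‖ ≤ 1 := fun i j => hMdef ▸ hint i j
  have hentry : dist (((ρ₁ σ : GL (Fin n) (PadicAlgCl p)) : Matrix (Fin n) (Fin n) (PadicAlgCl p)) i j)
      (((ρ₂ σ : GL (Fin n) (PadicAlgCl p)) : Matrix (Fin n) (Fin n) (PadicAlgCl p)) i j) = ‖(M ^ a * D) i j‖ := by
    rw [dist_eq_norm, ← Matrix.sub_apply, hdiff]
  rw [hentry, Matrix.mul_apply]
  refine IsUltrametricDist.norm_sum_le_of_forall_le_of_nonneg hε.le fun k _ => ?_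
  rw [norm_mul]
  calc ‖(M ^ a) i k‖ * ‖D k j‖ ≤ 1 * ε :=
        mul_le_mul (norm_pow_apply_le_one hint' a i k) (hD k j) (norm_nonneg _) zero_le_one
    _ = ε := one_mul ε

/-! #### Existence and uniqueness of points -/

omit [IsScalarTower (intermediateFieldIntegers p L) L (PadicAlgCl p)] in
/-- **`frameLiftAt x` at the Frobenius.** [folklore] -/
theorem frameLiftAt_frob_apply_coe (x : frameRing L n →ₐ[intermediateFieldIntegers p L] PadicAlgCl p) (i j : Fin n) :
    ((frameLiftAt L hσ₀ g x σ₀ : GL (Fin n) (PadicAlgCl p)) : Matrix (Fin n) (Fin n) (PadicAlgCl p)) i j =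
      algebraMap (intermediateFieldIntegers p L) (PadicAlgCl p)
          (frobMatrixLift L (g : Matrix (Fin n) (Fin n) (ResidueField (intermediateFieldIntegers p L))) i j) +
        x (frameVar L n (i, j)) := by
  rw [frameLiftAt_apply_coe, frameLift_frob, coe_univUnit, univMatrix, Matrix.add_apply, RingHom.mapMatrix_apply,
    Matrix.map_apply, Matrix.of_apply, map_add, AlgHom.commutes]

/-- **Every continuous unramified lift of `ρ̄` is a specialisation of the universal lift.**
[cite: Kisin2007, (3.3.3)] -/
theorem exists_framePoint_frameLiftAt_eq
    (ρbar : absoluteGaloisGroup K →* GL (Fin n) (ResidueField (intermediateFieldIntegers p L))) (hg : ρbar σ₀ = g)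
    (ρ : absoluteGaloisGroup K →* GL (Fin n) (PadicAlgCl p)) (hρc : Continuous ρ) (hρu : absInertia K ≤ ρ.ker)
    (hred : ReducesTo (intermediateFieldIntegers p L) ρ ρbar) :
    ∃ x : frameRing L n →ₐ[intermediateFieldIntegers p L] PadicAlgCl p, frameLiftAt L hσ₀ g x = ρ := by
  -- the values `t_{ij} = ρ(σ₀)_{ij} - ĝ_{ij}`
  let t : Fin n × Fin n → PadicAlgCl p := fun ij =>
    ((ρ σ₀ : GL (Fin n) (PadicAlgCl p)) : Matrix (Fin n) (Fin n) (PadicAlgCl p)) ij.1 ij.2 -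
      algebraMap (intermediateFieldIntegers p L) (PadicAlgCl p)
        (frobMatrixLift L (g : Matrix (Fin n) (Fin n) (ResidueField (intermediateFieldIntegers p L))) ij.1 ij.2)
  have ht : ∀ ij, ‖t ij‖ < 1 := fun ij => hred σ₀ ij.1 ij.2 _ (by
    rw [IsLocalRing.ResidueField.algebraMap_eq, residue_frobMatrixLift, hg])
  obtain ⟨x, hx⟩ := exists_framePoint_eq L n t ht
  refine ⟨x, ?_⟩
  have hfrob : frameLiftAt L hσ₀ g x σ₀ = ρ σ₀ := by
    refine Units.ext (Matrix.ext fun i j => ?_)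
    rw [frameLiftAt_frob_apply_coe, hx (i, j)]
    exact add_sub_cancel _ _
  have hO : ∀ a : intermediateFieldIntegers p L, ‖algebraMap (intermediateFieldIntegers p L) (PadicAlgCl p) a‖ ≤ 1 :=
    norm_algebraMap_integers_le_one L
  refine MonoidHom.eq_of_unramified_of_apply_frob_eq hσ₀ (continuous_frameLiftAt L hσ₀ g x) hρc
    (absInertia_le_ker_frameLiftAt L hσ₀ g x) hρu hfrob fun i j => ?_
  rw [hfrob]
  exact hred.norm_le_one hO (IsLocalRing.ResidueField.algebraMap_eq (R := intermediateFieldIntegers p L) ▸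
    residue_surjective) σ₀ i j

/-- **Uniqueness of the point**: `x ∘ frameLift` determines `x`. [cite: Kisin2007, (3.3.3)] -/
theorem framePoint_eq_of_frameLiftAt_eq {x₁ x₂ : frameRing L n →ₐ[intermediateFieldIntegers p L] PadicAlgCl p}
    (h : frameLiftAt L hσ₀ g x₁ = frameLiftAt L hσ₀ g x₂) : x₁ = x₂ := by
  refine framePoint_ext L n fun ij => ?_
  have h1 := congrArg (fun ρ : absoluteGaloisGroup K →* GL (Fin n) (PadicAlgCl p) =>
    ((ρ σ₀ : GL (Fin n) (PadicAlgCl p)) : Matrix (Fin n) (Fin n) (PadicAlgCl p)) ij.1 ij.2) h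
  simp only [frameLiftAt_frob_apply_coe] at h1
  exact add_left_cancel h1

end Points

end Literature.NumberTheory.GaloisRepresentations

end
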